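import Literature.Computability.AlgebraicComplexity.MS21ANFDerivativeStructure
import Literature.Computability.AlgebraicComplexity.MS21ROFProductHitting
import Literature.Computability.AlgebraicComplexity.MS21DiagonalTensorDerivatives
import HarnessLib

/-!
# Medini–Shpilka 2021, Thm 35 (equal depth): sibling leaves of `ANF_Δ`, hitting first-order
# leaf-derivatives `(Σ_i c_i ∂_i ANF_Δ)(Ax+b)`, and the case of DIFFERENT leaf spans

Theorem-only companion of `MS21DenseOrbitsHittingSets.lean` (cell `val-lit`, seat x5 g3; registry
claim `MS2021_thm_35`, partial by design — fourth file). Source: D. Medini, A. Shpilka, CCC 2021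
(LIPIcs 200:19) = arXiv:2102.05632, §5.2 (arXiv p0026–p0031) and §5 structure of `ANF_Δ` (p0025).

* **Sibling leaves** (Def 5.6 `sib`, Obs 5.7/5.8): every leaf `x_i` of `ANF_{Δ+1}` has a sibling
  leaf `x_{i'}` under a common product gate, and `ANF_{Δ+1} = x_i x_{i'} · P + R` with `P ≠ 0` and
  `P, R` free of `x_i, x_{i'}` (`exists_sibling_decomposition`; "every monomial of `∂ANF/∂x_i` is
  divisible by `sib(x_i)` and is not divisible by `x_i`", p0025:L67–L68). Unfolding by blocks:
  `ANF_{Δ+1} = A^{(b)} A^{(1-b)} + A^{(b+2)} A^{(1-(b+2))}` for every block `b` (`anf_succ_eq_block`).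
* **Isolating one leaf-derivative** (the mechanism of Lemmas 5.14/5.15 at first order): for
  `D = Σ_w c_w ∂_w ANF_{Δ+1}`, the derivative along the sibling `x_{i'}` followed by `x_i := 0` leaves
  `c_i · P` (`aeval_kill_pderiv_sum_C_mul_pderiv_of_sibling`), a nonzero constant times a read-once
  polynomial.
* **L1D — hitting first-order leaf-derivatives of an ANF orbit**
  (`bind₁_affSubst_sum_C_mul_pderiv_anf_ne_zero`): for `c ≠ 0` and `(A, b) ∈ GLaff_n`,
  `(Σ_w c_w ∂_w ANF_Δ)(Ax + b) ∘ G ≠ 0` for every `B`-independent `G` with `B ≥ t + 3`,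
  `4^Δ ≤ 2^t` — one dual derivative (Lemma 3.8/3.9), one kill (Lemma 3.10), then Thm 33 on the
  orbit of `P`, packaged by t18's engine `bind₁_affSubst_ne_zero_of_kill_pderivs_eq_prod`
  (`MS21ROFProductHitting.lean`). This is the first-order analogue of the printed Lemma 5.15
  (p0030:L1–L26), used in the proof of Thm 35 at p0030:L28–L31 ("From (lem:pitDerivRoanf) it follows
  that any `[(2Δ₁+5)]` `G'` satisfies `∂f/∂v ∘ G' ≠ 0`").
* Directional derivatives of orbit elements along an arbitrary direction are t18's
  `MS2021.dirDeriv_affSubst` (`MS21DiagonalTensorDerivatives.lean`): `∂_v (g(Ax+b)) =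
  (Σ_w (Av)_w ∂_w g)(Ax + b)`.
* **Thm 35, equal depth, DIFFERENT leaf spans** (`bind₁_anf_affSubst_sub_ne_zero_of_offBlock`,
  `MS2021_thm_35_of_offBlock`): if `f₁ = ANF_Δ(A₁x+b₁)`, `f₂ = ANF_Δ(A₂x+b₂)` and the linear span of
  the leaf forms of `f₁` is not contained in that of `f₂` — concretely, `(A₁A₂⁻¹)_{i₀ j₁} ≠ 0` for some
  leaf row `i₀ < 4^Δ` and column `j₁ ≥ 4^Δ` — then `(f₁ - f₂) ∘ G ≠ 0` for every `(2Δ+7)`-independent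
  `G` (indeed every `B+1`-independent one with `B ≥ 2Δ+3`), EVERY field; uniformity is not used in
  this sub-case. Printed counterpart: p0030:L28–L31 ("There must exist some `i` such that `ℓ_i` is not
  spanned by the linear functions at the leaves of `f₂`. Fix `v` with `ℓ^{[1]}(v) = 0` for every leaf
  `ℓ` of `f₂` and `ℓ_i^{[1]}(v) = 1` … `0 ≠ ∂f/∂v = ∂f₁/∂v`"), stated there for `Δ₁ ≠ Δ₂` and used here
  for equal depths — the argument is the same. ROUTE (disclosed, owner's ruling 02:47Z on the cell
  bus): affine throughout, no homogenisation. Residual of `MS2021_thm_35` after this file: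
  `Δ₁ = Δ₂` with EQUAL leaf spans (the printed homogeneous core, Lemmas 5.12–5.15 + `pitRoanfSame`).

No definitions, no new named facts (D-0026). HONEST FRAMING: partial results toward a typed
literature statement; `VP ≠ VNP` is NOT proved and nothing here bears on it.

## References
* [MediniShpilka2021] D. Medini, A. Shpilka, CCC 2021, LIPIcs 200:19 = arXiv:2102.05632: Def 5.6,
  Obs 5.7, Obs 5.8, Cor 5.10 (arXiv p0025:L43–L70); Lemmas 3.8–3.10 (p0017–p0018); Thm 33; Thm 35
  (CCC p.19:13; arXiv p0008:L29–30) and its proof §5.2 (p0030:L1–L31).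
-/

noncomputable section

open MvPolynomial Matrix

namespace Literature.Computability.AlgebraicComplexity

namespace MS2021

/-! ### Small `vars`/`pderiv` plumbing -/

section Plumbing

variable {R : Type*} [CommSemiring R] {σ τ : Type*}

/-- Derivatives do not create variables: `degreeOf x (∂_w p) ≤ degreeOf x p`. [folklore] -/
private theorem degreeOf_pderiv_le_degreeOf (x w : σ) (p : MvPolynomial σ R) :
    degreeOf x (pderiv w p) ≤ degreeOf x p := by
  classical
  rw [degreeOf_le_iff]
  intro m hm
  rw [mem_support_iff, coeff_pderiv] at hm
  have hc : coeff (m + Finsupp.single w 1) p ≠ 0 := fun h => hm (by rw [h, zero_mul])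
  have hsup := (degreeOf_le_iff (n := x) (f := p) (d := degreeOf x p)).1 le_rfl
    (m + Finsupp.single w 1) (mem_support_iff.2 hc)
  have hle : m x ≤ (m + Finsupp.single w 1 : σ →₀ ℕ) x := by
    rw [Finsupp.add_apply]; exact Nat.le_add_right _ _
  exact hle.trans hsup

/-- A variable absent from `p` is absent from `∂_w p`. [folklore] -/
private theorem notMem_vars_pderiv {x : σ} {p : MvPolynomial σ R} (hx : x ∉ p.vars) (w : σ) :
    x ∉ (pderiv w p).vars := by
  intro h
  have h1 := mem_vars_iff_degreeOf_ne_zero.1 h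
  have h2 : degreeOf x p = 0 := by
    by_contra hne
    exact hx (mem_vars_iff_degreeOf_ne_zero.2 hne)
  exact h1 (Nat.le_zero.1 (h2 ▸ degreeOf_pderiv_le_degreeOf x w p))

/-- A variable outside the range of a renaming is absent from the renamed polynomial. [folklore] -/
private theorem notMem_vars_rename_of_forall_ne [DecidableEq τ] (e : σ → τ) {x : τ}
    (hx : ∀ j, e j ≠ x) (p : MvPolynomial σ R) : x ∉ (rename e p).vars := by
  classical
  intro h
  obtain ⟨j, -, hj⟩ := Finset.mem_image.1 (vars_rename e p h)
  exact hx j hj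

/-- Absent upstairs and injective renaming: absent downstairs. [folklore] -/
private theorem notMem_vars_rename_of_notMem [DecidableEq τ] {e : σ → τ} (he : Function.Injective e)
    {j : σ} {p : MvPolynomial σ R} (hj : j ∉ p.vars) : e j ∉ (rename e p).vars := by
  classical
  intro h
  obtain ⟨j', hj', hjj'⟩ := Finset.mem_image.1 (vars_rename e p h)
  exact hj (he hjj' ▸ hj')

/-- `vars` of a product of two and of a sum: membership transfers to a factor / summand. [folklore] -/
private theorem notMem_vars_mul_add [DecidableEq σ] {x : σ} {p q r s : MvPolynomial σ R}
    (hp : x ∉ p.vars) (hq : x ∉ q.vars) (hr : x ∉ r.vars) (hs : x ∉ s.vars) :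
    x ∉ (p * q + r * s).vars := by
  intro h
  rcases Finset.mem_union.1 (vars_add_subset _ _ h) with h | h
  · rcases Finset.mem_union.1 (vars_mul _ _ h) with h | h
    · exact hp h
    · exact hq h
  · rcases Finset.mem_union.1 (vars_mul _ _ h) with h | h
    · exact hr h
    · exact hs h

end Plumbing

/-! ### `ANF_{Δ+1}` by blocks, and the sibling decomposition -/

section Sibling

variable (K : Type*) [Field K]

/-- `ANF_{Δ+1} = A^{(b)}·A^{(1-b)} + A^{(b+2)}·A^{(1-(b+2))}` for every block `b` (the two product gates
under the root, listed starting from the one containing block `b`; `1 - b` is the sibling block).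
[cite: MediniShpilka2021, Def 8 / Def 5.4 (CCC p.19:7; arXiv p0025:L31-L37)] -/
theorem anf_succ_eq_block (Δ : ℕ) (b : Fin 4) : anf K (Δ + 1) =
    rename (anfBlock Δ b) (anf K Δ) * rename (anfBlock Δ (1 - b)) (anf K Δ) +
      rename (anfBlock Δ (b + 2)) (anf K Δ) * rename (anfBlock Δ (1 - (b + 2))) (anf K Δ) := by
  rw [anf_succ]
  have h12 : (1 : Fin 4) - 2 = 3 := by decide
  have h13 : (1 : Fin 4) - 3 = 2 := by decide
  have h1p2 : (1 : Fin 4) + 2 = 3 := by decide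
  have h2p2 : (2 : Fin 4) + 2 = 0 := by decide
  have h3p2 : (3 : Fin 4) + 2 = 1 := by decide
  fin_cases b
  · simp only [Fin.zero_eta, Fin.isValue, sub_zero, zero_add, h12]
  · simp only [Fin.mk_one, Fin.isValue, sub_self, h1p2, h13]
    ring
  · simp only [Fin.reduceFinMk, Fin.isValue, h12, h2p2, sub_zero]
    ring
  · simp only [Fin.reduceFinMk, Fin.isValue, h13, h3p2, sub_self]
    ring

/-- **Sibling leaves and the sibling decomposition of `ANF_{Δ+1}`** (Def 5.6 / Obs 5.7–5.8): every
leaf `x_i` has a sibling leaf `x_{i'} ≠ x_i` (the other child of the bottom product gate) with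
`ANF_{Δ+1} = x_i · x_{i'} · P + R`, `P ≠ 0`, and `P, R` not involving `x_i, x_{i'}` — so every monomial
containing `x_{i'}` contains `x_i`, `∂²ANF/∂x_{i'}∂x_i = P` is the product of the higher siblings,
and `∂ANF/∂x_i = x_{i'} P` ("every monomial of `∂ANF/∂x_i` is divisible by `sib(x_i)` and is not
divisible by `x_i`"). [cite: MediniShpilka2021, Def 5.6, Obs 5.7, Obs 5.8, proof of Cor 5.10 (arXiv p0025:L46-L68)] -/
theorem exists_sibling_decomposition : ∀ (Δ : ℕ) (i : Fin (4 ^ (Δ + 1))),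
    ∃ i' : Fin (4 ^ (Δ + 1)), i' ≠ i ∧ ∃ P R : MvPolynomial (Fin (4 ^ (Δ + 1))) K,
      anf K (Δ + 1) = X i * X i' * P + R ∧ P ≠ 0 ∧
        i ∉ P.vars ∧ i' ∉ P.vars ∧ i ∉ R.vars ∧ i' ∉ R.vars
  | 0, i => by
    classical
    obtain ⟨b, j, rfl⟩ := exists_eq_anfBlock 0 i
    obtain rfl : j = ⟨0, by norm_num⟩ := by
      ext; have := j.2; simp only [pow_zero] at this; simp only; omega
    set j₀ : Fin (4 ^ 0) := ⟨0, by norm_num⟩ with hj₀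
    have hanf0 : anf K 0 = X j₀ := by simp only [anf, hj₀]
    have hr : ∀ a : Fin 4, rename (anfBlock 0 a) (anf K 0) = X (anfBlock 0 a j₀) := by
      intro a; rw [hanf0, rename_X]
    have hsib : (1 : Fin 4) - b ≠ b := by revert b; decide
    have hb2 : b + 2 ≠ b := by revert b; decide
    have hb3 : 1 - (b + 2) ≠ b := by revert b; decide
    have hb2' : b + 2 ≠ 1 - b := by revert b; decide
    have hb3' : 1 - (b + 2) ≠ 1 - b := by revert b; decide
    have hne : ∀ {a a' : Fin 4}, a ≠ a' → anfBlock 0 a j₀ ≠ anfBlock 0 a' j₀ :=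
      fun h e => h (anfBlock_inj e).1
    refine ⟨anfBlock 0 (1 - b) j₀, hne hsib, 1,
      X (anfBlock 0 (b + 2) j₀) * X (anfBlock 0 (1 - (b + 2)) j₀), ?_, one_ne_zero, ?_, ?_, ?_, ?_⟩
    · rw [anf_succ_eq_block K 0 b, hr, hr, hr, hr, mul_one]
    · simp
    · simp
    · intro h
      rcases Finset.mem_union.1 (vars_mul _ _ h) with h | h <;>
        rw [vars_X, Finset.mem_singleton] at h
      · exact hne hb2 h.symm
      · exact hne hb3 h.symm
    · intro h
      rcases Finset.mem_union.1 (vars_mul _ _ h) with h | h <;>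
        rw [vars_X, Finset.mem_singleton] at h
      · exact hne hb2' h.symm
      · exact hne hb3' h.symm
  | Δ + 1, i => by
    classical
    obtain ⟨b, j, rfl⟩ := exists_eq_anfBlock (Δ + 1) i
    obtain ⟨j', hj', P₀, R₀, hdec, hP₀, hjP, hj'P, hjR, hj'R⟩ := exists_sibling_decomposition Δ j
    -- notation for the renamed copies
    set r : Fin 4 → MvPolynomial (Fin (4 ^ (Δ + 1))) K → MvPolynomial (Fin (4 ^ (Δ + 2))) K :=
      fun a p => rename (anfBlock (Δ + 1) a) p with hr
    have hsib : (1 : Fin 4) - b ≠ b := by revert b; decide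
    have hb2 : b + 2 ≠ b := by revert b; decide
    have hb3 : 1 - (b + 2) ≠ b := by revert b; decide
    -- absence of `x^{(b)}_j`, `x^{(b)}_{j'}` from renamed copies
    have hoff : ∀ {a : Fin 4} (ha : a ≠ b) (jj : Fin (4 ^ (Δ + 1))) (p : MvPolynomial _ K),
        anfBlock (Δ + 1) b jj ∉ (r a p).vars := fun ha jj p =>
      notMem_vars_rename_of_forall_ne _ (fun j'' e => ha (anfBlock_inj e).1) p
    have hon : ∀ {jj : Fin (4 ^ (Δ + 1))} {p : MvPolynomial _ K}, jj ∉ p.vars →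
        anfBlock (Δ + 1) b jj ∉ (r b p).vars := fun hjj =>
      notMem_vars_rename_of_notMem (anfBlock_injective (Δ + 1) b) hjj
    refine ⟨anfBlock (Δ + 1) b j', fun e => hj' (anfBlock_inj e).2,
      r b P₀ * r (1 - b) (anf K (Δ + 1)),
      r b R₀ * r (1 - b) (anf K (Δ + 1)) + r (b + 2) (anf K (Δ + 1)) * r (1 - (b + 2)) (anf K (Δ + 1)),
      ?_, ?_, ?_, ?_, ?_, ?_⟩
    · rw [anf_succ_eq_block K (Δ + 1) b]
      simp only [hr, hdec, map_add, map_mul, rename_X]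
      ring
    · refine mul_ne_zero ?_ ?_
      · exact fun h => hP₀ ((rename_injective _ (anfBlock_injective _ _)).eq_iff' (map_zero _) |>.1 h)
      · exact fun h => anf_ne_zero K _
          ((rename_injective _ (anfBlock_injective _ _)).eq_iff' (map_zero _) |>.1 h)
    · intro h
      rcases Finset.mem_union.1 (vars_mul _ _ h) with h | h
      · exact hon hjP h
      · exact hoff hsib.symm.symm _ _ h
    · intro h
      rcases Finset.mem_union.1 (vars_mul _ _ h) with h | h
      · exact hon hj'P h
      · exact hoff hsib.symm.symm _ _ h
    · exact notMem_vars_mul_add (hon hjR) (hoff hsib.symm.symm _ _) (hoff hb2 _ _) (hoff hb3 _ _)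
    · exact notMem_vars_mul_add (hon hj'R) (hoff hsib.symm.symm _ _) (hoff hb2 _ _) (hoff hb3 _ _)

end Sibling

/-! ### Isolating one leaf-derivative: sibling derivative, then kill -/

section Isolate

variable {K : Type*} [Field K] {σ : Type*} [DecidableEq σ] [Fintype σ]

/-- **Isolating the `x_i`-derivative.** If `F = x_i x_{i'} P + R` with `P, R` free of `x_i, x_{i'}`
(`i' ≠ i`), then for every coefficient vector `u`,
`(∂_{i'} (Σ_w u_w ∂_w F))|_{x_i = 0} = u_i · P` — the mechanism of Lemma 5.14 (derivatives along
siblings, then kills) at first order. [cite: MediniShpilka2021, proof of Lemma 5.14 (arXiv p0029:L20-L26) and Obs 5.8] -/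
theorem aeval_kill_pderiv_sum_C_mul_pderiv_of_sibling {F P R : MvPolynomial σ K} {i i' : σ}
    (hii' : i' ≠ i) (hF : F = X i * X i' * P + R) (hiP : i ∉ P.vars) (hi'P : i' ∉ P.vars)
    (hiR : i ∉ R.vars) (hi'R : i' ∉ R.vars) (u : σ → K) :
    aeval (fun w => if w ∈ ({i} : Finset σ) then (0 : MvPolynomial σ K) else X w)
        (pderiv i' (∑ w, C (u w) * pderiv w F)) = C (u i) * P := by
  classical
  -- first derivatives of `F`
  have hPi : pderiv i P = 0 := pderiv_eq_zero_of_notMem_vars hiP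
  have hPi' : pderiv i' P = 0 := pderiv_eq_zero_of_notMem_vars hi'P
  have hRi : pderiv i R = 0 := pderiv_eq_zero_of_notMem_vars hiR
  have hRi' : pderiv i' R = 0 := pderiv_eq_zero_of_notMem_vars hi'R
  have hFi : pderiv i F = X i' * P := by
    rw [hF, map_add, pderiv_mul, pderiv_mul, pderiv_X_self, pderiv_X_of_ne hii', hPi, hRi]; ring
  have hFi' : pderiv i' F = X i * P := by
    rw [hF, map_add, pderiv_mul, pderiv_mul, pderiv_X_self, pderiv_X_of_ne (Ne.symm hii'), hPi',
      hRi']; ring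
  have hFw : ∀ w, w ≠ i → w ≠ i' → pderiv w F = X i * X i' * pderiv w P + pderiv w R := by
    intro w hwi hwi'
    rw [hF, map_add, pderiv_mul, pderiv_mul, pderiv_X_of_ne (Ne.symm hwi),
      pderiv_X_of_ne (Ne.symm hwi')]
    ring
  -- second derivatives `∂_{i'} ∂_w F`
  have hS : ∀ w, pderiv i' (pderiv w F) =
      (if w = i then P else 0) + X i * (if w = i ∨ w = i' then 0 else pderiv w P) := by
    intro w
    by_cases hwi : w = i
    · subst hwi
      rw [if_pos rfl, if_pos (Or.inl rfl), hFi, pderiv_mul, pderiv_X_self, hPi']; ring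
    · by_cases hwi' : w = i'
      · subst hwi'
        rw [if_neg hwi, if_pos (Or.inr rfl), hFi', pderiv_mul, pderiv_X_of_ne (Ne.symm hwi), hPi']
        ring
      · rw [if_neg hwi, if_neg (not_or.2 ⟨hwi, hwi'⟩), hFw w hwi hwi', map_add, pderiv_mul,
          pderiv_mul, pderiv_X_of_ne (Ne.symm hii'), pderiv_X_self,
          pderiv_eq_zero_of_notMem_vars (notMem_vars_pderiv hi'P w),
          pderiv_eq_zero_of_notMem_vars (notMem_vars_pderiv hi'R w)]
        ring
  -- the derivative of the combination
  have hD : pderiv i' (∑ w, C (u w) * pderiv w F) =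
      C (u i) * P + X i * ∑ w, C (u w) * (if w = i ∨ w = i' then 0 else pderiv w P) := by
    rw [map_sum]
    simp_rw [pderiv_C_mul, hS, mul_add, Finset.sum_add_distrib]
    congr 1
    · simp_rw [mul_ite, mul_zero]
      rw [Finset.sum_ite_eq' Finset.univ i, if_pos (Finset.mem_univ _)]
    · rw [Finset.mul_sum]
      refine Finset.sum_congr rfl fun w _ => ?_
      ring
  -- kill `x_i`
  rw [hD, map_add, map_mul, map_mul, algHom_C, MvPolynomial.algebraMap_eq, aeval_X,
    if_pos (Finset.mem_singleton_self i), zero_mul, add_zero]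
  congr 1
  -- `P` is free of `x_i`
  have hfix : aeval (fun w => if w ∈ ({i} : Finset σ) then (0 : MvPolynomial σ K) else X w) P =
      aeval X P := by
    refine MvPolynomial.hom_congr_vars (f₁ := (aeval _ : MvPolynomial σ K →ₐ[K] _).toRingHom)
      (f₂ := (aeval X : MvPolynomial σ K →ₐ[K] _).toRingHom) ?_ (fun w hw _ => ?_) rfl
    · ext c
      simp
    · have hwi : w ≠ i := fun e => hiP (e ▸ hw)
      simp [Finset.mem_singleton, hwi]
  rw [hfix, aeval_X_left_apply]

end Isolate

/-! ### L1D: hitting first-order leaf-derivatives of an ANF orbit -/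

section FirstDerivativeHitting

variable {K : Type*} [Field K] {n : ℕ}

/-- **Hitting `(Σ_w c_w ∂_w ANF_Δ)(Ax + b)`** (first-order analogue of Lemma 5.15, used at
p0030:L28–L31): for `c ≠ 0` and invertible affine `(A, b)`, every `B`-independent map with
`B ≥ t + 3`, `4^Δ ≤ 2^t`, hits it — derivative along the sibling leaf, kill, Thm 33 (t18's engine
`bind₁_affSubst_ne_zero_of_kill_pderivs_eq_prod`).
[cite: MediniShpilka2021, Lemma 5.15 and proof of Thm 35 (arXiv p0030:L1-L31); Cor 5.10; Thm 33] -/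
theorem bind₁_affSubst_sum_C_mul_pderiv_anf_ne_zero {Δ t B c : ℕ} (u : Fin (4 ^ Δ) → K)
    (hu : u ≠ 0) (h : 4 ^ Δ ≤ n) {A : Matrix (Fin n) (Fin n) K} (hA : IsUnit A.det)
    (b : Fin n → K) (ht : 4 ^ Δ ≤ 2 ^ t) (G : Fin n → MvPolynomial (Fin B × (Fin c ⊕ Unit)) K)
    (hG : IsIndependent B G) (hB : t + 3 ≤ B) :
    bind₁ G (affSubst h A b (∑ w, C (u w) * pderiv w (anf K Δ))) ≠ 0 := by
  classical
  cases Δ with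
  | zero =>
    -- `ANF_0 = x_1`: the combination is the nonzero constant `u_0`
    have hj : ∀ x : Fin (4 ^ 0), x = ⟨0, by norm_num⟩ := fun x => by
      ext; have := x.2; simp only [pow_zero] at this; simp only; omega
    have huniv : (Finset.univ : Finset (Fin (4 ^ 0))) = {⟨0, by norm_num⟩} := by
      ext x; simp [hj x]
    have h0 : u ⟨0, by norm_num⟩ ≠ 0 := by
      intro h0; apply hu; funext x; rw [hj x]; exact h0
    rw [huniv, Finset.sum_singleton]
    simp only [anf, pderiv_X_self, mul_one, affSubst_C, bind₁_C_right, Ne, C_eq_zero]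
    exact h0
  | succ Δ =>
    obtain ⟨i₀, hi₀⟩ : ∃ x, u x ≠ 0 := by
      by_contra hall; push Not at hall; exact hu (funext hall)
    obtain ⟨i', hi'i, P, R, hdec, hP, hiP, hi'P, hiR, hi'R⟩ := exists_sibling_decomposition K Δ i₀
    have hform := aeval_kill_pderiv_sum_C_mul_pderiv_of_sibling hi'i hdec hiP hi'P hiR hi'R u
    -- `P` is read-once on all leaves (derivative of a derivative of `ANF`)
    have hPeq : P = pderiv i' (pderiv i₀ (anf K (Δ + 1))) := by
      have hPi' : pderiv i' P = 0 := pderiv_eq_zero_of_notMem_vars hi'P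
      rw [hdec, map_add, pderiv_mul, pderiv_mul, pderiv_X_self, pderiv_X_of_ne hi'i,
        pderiv_eq_zero_of_notMem_vars hiP, pderiv_eq_zero_of_notMem_vars hiR, map_add]
      simp only [mul_zero, add_zero, one_mul, map_zero]
      rw [pderiv_mul, pderiv_X_self, hPi']; ring
    have hROP : IsROP (Finset.univ : Finset (Fin (4 ^ (Δ + 1)))) P := by
      rw [hPeq]; exact ((isROP_anf K (Δ + 1)).isROP_pderiv i₀).isROP_pderiv i'
    have hcard : (Finset.univ : Finset (Fin (4 ^ (Δ + 1)))).card ≤ 2 ^ t := by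
      rwa [Finset.card_univ, Fintype.card_fin]
    refine bind₁_affSubst_ne_zero_of_kill_pderivs_eq_prod (ι := Unit) (t := t) (a := 1)
      (∑ w, C (u w) * pderiv w (anf K (Δ + 1))) (fun _ => i') {i₀} {()} (fun _ => P)
      (fun _ => Finset.univ) (u i₀) (fun _ _ => hROP) (fun _ _ => hcard) ?_ ?_ h hA b G hG ?_
    · rw [List.ofFn_succ, List.ofFn_zero, List.foldr_cons, List.foldr_nil, hform,
        Finset.prod_singleton]
    · rw [Finset.prod_singleton]
      exact mul_ne_zero (by rwa [Ne, C_eq_zero]) hP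
    · rw [Finset.card_singleton]; omega

end FirstDerivativeHitting

/-! ### Thm 35, equal depth, different leaf spans -/

section OffBlock

variable {K : Type*} [Field K] {n : ℕ}

/-- **Thm 35, equal depth, different leaf spans** (explicit witnesses): if some entry of `A₁A₂⁻¹` in a
leaf row `i₀ < 4^Δ` and a column `j₁ ≥ 4^Δ` is nonzero — i.e. the leaf form `ℓ_{1,i₀}` of `f₁` is not in
the span of the leaf forms of `f₂` — then `(f₁ - f₂) ∘ G ≠ 0` for `f_i = ANF_Δ(A_i x + b_i)` and every
`(B+1)`-independent `G`, `B ≥ t + 3`, `4^Δ ≤ 2^t`: the derivative along `v = A₂⁻¹ e_{j₁}` kills `f₂` and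
turns `f₁` into `(Σ_w (A₁v)_w ∂_w ANF_Δ)(A₁x + b₁)` with `(A₁v)_{i₀} ≠ 0`.
[cite: MediniShpilka2021, proof of Thm 35 / Lemma pitSumOfRoanf (arXiv p0030:L28-L31); Lemmas 3.8, 3.9; Cor 5.10] -/
theorem bind₁_anf_affSubst_sub_ne_zero_of_offBlock {Δ t B c : ℕ} (h : 4 ^ Δ ≤ n)
    {A₁ A₂ : Matrix (Fin n) (Fin n) K} (hA₁ : IsUnit A₁.det) (hA₂ : IsUnit A₂.det)
    (b₁ b₂ : Fin n → K) {i₀ : Fin (4 ^ Δ)} {j₁ : Fin n} (hj₁ : 4 ^ Δ ≤ (j₁ : ℕ))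
    (hne : (A₁ * A₂⁻¹) (Fin.castLE h i₀) j₁ ≠ 0) (ht : 4 ^ Δ ≤ 2 ^ t)
    {G : Fin n → MvPolynomial (Fin (B + 1) × (Fin c ⊕ Unit)) K} (hG : IsIndependent (B + 1) G)
    (hB : t + 3 ≤ B) :
    bind₁ G (affSubst h A₁ b₁ (anf K Δ) - affSubst h A₂ b₂ (anf K Δ)) ≠ 0 := by
  classical
  obtain ⟨G₁, G', hG₁, hG', hGeq⟩ := isIndependent_succ_iff.1 hG
  rw [show G = fun j => rename (Prod.mk 0) (G₁ j) + rename (Prod.map Fin.succ id) (G' j) from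
    funext hGeq]
  -- the direction `v = A₂⁻¹ e_{j₁}`
  set v : Fin n → K := fun j => A₂⁻¹ j j₁ with hv
  refine bind₁_peel_ne_zero_of_dirDeriv hG₁ G' _ v ?_
  have hmv : ∀ (A : Matrix (Fin n) (Fin n) K) (k : Fin n), (A *ᵥ v) k = (A * A₂⁻¹) k j₁ := by
    intro A k
    rw [Matrix.mulVec, dotProduct, Matrix.mul_apply]
  -- `∂_v f₂ = 0`
  have h2 : (∑ j, C (v j) * pderiv j (affSubst h A₂ b₂ (anf K Δ))) = 0 := by
    rw [dirDeriv_affSubst]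
    have hzero : ∀ w : Fin (4 ^ Δ), (A₂ *ᵥ v) (Fin.castLE h w) = 0 := by
      intro w
      rw [hmv, Matrix.mul_nonsing_inv _ hA₂, Matrix.one_apply, if_neg]
      intro e
      have := congrArg Fin.val e
      simp only [Fin.val_castLE] at this
      have := w.2
      omega
    simp_rw [hzero, C_0, zero_mul, Finset.sum_const_zero]
    unfold affSubst
    exact map_zero _
  -- `∂_v f₁ = (Σ_w u_w ∂_w ANF)(A₁x + b₁)` with `u_{i₀} ≠ 0`
  set u : Fin (4 ^ Δ) → K := fun w => (A₁ *ᵥ v) (Fin.castLE h w) with hu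
  have hu0 : u ≠ 0 := by
    intro h0
    have := congrFun h0 i₀
    rw [hu] at this
    dsimp only at this
    rw [hmv, Pi.zero_apply] at this
    exact hne this
  have h1 : (∑ j, C (v j) * pderiv j (affSubst h A₁ b₁ (anf K Δ))) =
      affSubst h A₁ b₁ (∑ w, C (u w) * pderiv w (anf K Δ)) :=
    dirDeriv_affSubst h A₁ b₁ _ v
  have hsplit : (∑ j, C (v j) * pderiv j (affSubst h A₁ b₁ (anf K Δ) - affSubst h A₂ b₂ (anf K Δ))) =
      (∑ j, C (v j) * pderiv j (affSubst h A₁ b₁ (anf K Δ))) -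
        ∑ j, C (v j) * pderiv j (affSubst h A₂ b₂ (anf K Δ)) := by
    rw [← Finset.sum_sub_distrib]
    refine Finset.sum_congr rfl fun j _ => ?_
    rw [map_sub, mul_sub]
  rw [hsplit, h2, sub_zero, h1]
  exact bind₁_affSubst_sum_C_mul_pderiv_anf_ne_zero u hu0 h hA₁ b₁ ht G' hG' hB

end OffBlock

end MS2021

/-! ### Thm 35 for `Δ₁ = Δ₂` with different leaf spans, in the typed shape -/

section Thm35OffBlock

open MS2021

/-- **MS Thm 35, case `Δ₁ = Δ₂ = Δ`, DIFFERENT leaf spans**, every field: for `f₁ = ANF_Δ(A₁x+b₁)`,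
`f₂ = ANF_Δ(A₂x+b₂)` with `(A₁, b₁), (A₂, b₂) ∈ GLaff_n`, if some entry of `A₁A₂⁻¹` or of `A₂A₁⁻¹` in a
leaf row `< 4^Δ` and a column `≥ 4^Δ` is nonzero (the linear spans of the two leaf systems differ),
then `(f₁ - f₂) ∘ G ≠ 0` for every `(2 max{Δ,Δ} + 7)`-independent `G` (uniformity unused here).
[cite: MediniShpilka2021, Thm 35 (CCC p.19:13; = arXiv ‹pitSumOfRoanfThm› p0008.txt:L29-30); proof p0030:L28-L31] -/
theorem MS2021_thm_35_of_offBlock (K : Type) [Field K] (n Δ c : ℕ) (h : 4 ^ Δ ≤ n)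
    {A₁ A₂ : Matrix (Fin n) (Fin n) K} (hA₁ : IsUnit A₁.det) (hA₂ : IsUnit A₂.det)
    (b₁ b₂ : Fin n → K)
    (hoff : ∃ (i₀ : Fin (4 ^ Δ)) (j₁ : Fin n), 4 ^ Δ ≤ (j₁ : ℕ) ∧
      ((A₁ * A₂⁻¹) (Fin.castLE h i₀) j₁ ≠ 0 ∨ (A₂ * A₁⁻¹) (Fin.castLE h i₀) j₁ ≠ 0))
    (G : Fin n → MvPolynomial (Fin (2 * max Δ Δ + 7) × (Fin c ⊕ Unit)) K)
    (hG : IsIndependent (2 * max Δ Δ + 7) G) :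
    bind₁ G (affSubst h A₁ b₁ (anf K Δ) - affSubst h A₂ b₂ (anf K Δ)) ≠ 0 := by
  obtain ⟨i₀, j₁, hj₁, hne⟩ := hoff
  have ht : 4 ^ Δ ≤ 2 ^ (2 * Δ) := by rw [pow_mul]; norm_num
  have hB : 2 * Δ + 3 ≤ 2 * max Δ Δ + 6 := by rw [max_self]; omega
  rcases hne with hne | hne
  · exact bind₁_anf_affSubst_sub_ne_zero_of_offBlock (B := 2 * max Δ Δ + 6) h hA₁ hA₂ b₁ b₂ hj₁
      hne ht hG hB
  · have key := bind₁_anf_affSubst_sub_ne_zero_of_offBlock (B := 2 * max Δ Δ + 6) h hA₂ hA₁ b₂ b₁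
      hj₁ hne ht hG hB
    intro h0
    apply key
    rw [← neg_sub, map_neg, h0, neg_zero]

end Thm35OffBlock

end Literature.Computability.AlgebraicComplexity

end
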